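import Literature.Topology.FourManifolds.SPC4HandlesNormHolds
import Literature.Topology.FourManifolds.OneHandleStepExists
import HarnessLib

/-!
# Discharge of h₃: the orientation-reversing, `π₁`-trivial, extendable boundary diffeomorphism
# of a compact connected orientable `4`-dimensional `1`-handlebody

Topic `Literature/Topology/FourManifolds`; fact seat
`provefact-Literature.Topology.FourManifolds.exists-2ab35b343d` on
`Literature.Topology.FourManifolds.exists_diffeoExtends_isOrientationReversing` (**h₃** of the
Laudenbach–Poénaru DAG of `SPC4HandlesProofs.lean`; Laudenbach–Poénaru, Bull. SMF 100 (1972),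
§2, p. 342, diagram (5): the reflection of `♮k S¹ × B³` in a hyperplane through the core
circles).  Everything here is **proved**; no definition and no named fact is introduced.

The tree reduces h₃ to the uniqueness of attaching one `1`-handle L1
(`oneHandle_nonempty_diffeomorph`; Kosinski (1993), VI (6.6), (11.4)(c)) alone:
`exists_diffeoExtends_isOrientationReversing_of_oneHandle` (`SPC4HandlesNormHolds.lean`) — the
normal form NORM (`exists_hasHandleDecomposition_handleCount_one_holds`, from Milnor's First
Cancellation Theorem 5.4 with the deformation leaf discharged) and the symmetry of the model
SYMMᴹ being theorems of the tree, and UNIQ₄ following from L1 by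
`nonempty_diffeomorph_of_hasHandleDecomposition_handleCount_one_of_oneHandle`
(`SPC4HandlesLeaves.lean`).  With L1 discharged (`oneHandle_nonempty_diffeomorph_holds`) the
discharge of h₃ is the composition of the two (L1 itself is discharged in
`OneHandleStepExists.lean`, from Milnor's Thm. 3.13 / Kosinski VI (6.4), (7.1)).

## References

* F. Laudenbach, V. Poénaru, *A note on 4-dimensional handlebodies*, Bull. Soc. Math. France
  100 (1972), 337–344: §2, proof of Thm. A, p. 342, diagram (5).  Held:
  `lit read doi-10-24033-bsmf-1741`. [LaudenbachPoenaruBSMF1972]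
* A. A. Kosinski, *Differential Manifolds*, Academic Press (1993), VI (6.6), §11, (11.4)(c).
  [Kosinski1993]
* R. Kirby, *The topology of `4`-manifolds*, LNM 1374 (1989), Ch. I §2, p. 8. [Kirby1989]
-/

noncomputable section

namespace Literature.Topology.FourManifolds

universe u

/-- **h₃, discharged: every compact connected orientable `4`-dimensional `1`-handlebody `V`
carries, for every boundary datum `b`, a self-diffeomorphism `ρ` of `b.carrier` which extends
over `V`, reverses every smooth orientation of `b.carrier`, fixes a point `z₀` and induces the
identity of `π₁(b.carrier, z₀)`** (`exists_diffeoExtends_isOrientationReversing`; the reflection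
of `♮k S¹ × B³` in a hyperplane through the core circles, transported to `V ≅ ♮k S¹ × B³`) —
`exists_diffeoExtends_isOrientationReversing_of_oneHandle` applied to the discharge of the
uniqueness of attaching one `1`-handle, `oneHandle_nonempty_diffeomorph_holds`.
[cite: LaudenbachPoenaruBSMF1972, §2, p. 342, diagram (5)] [cite: Kosinski1993, VI (6.6), (11.4)(c)]
[cite: Kirby1989, Ch. I §2, p. 8] -/
theorem exists_diffeoExtends_isOrientationReversing_holds :
    exists_diffeoExtends_isOrientationReversing.{u} :=
  exists_diffeoExtends_isOrientationReversing_of_oneHandle oneHandle_nonempty_diffeomorph_holds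

end Literature.Topology.FourManifolds

end
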